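import Mathlib
import Summits.ResolutionOfSingularities.ResolutionOfSingularities.Theses.Descent
import Literature.AlgebraicGeometry.Resolution.DiscreteSeparableResidueLocalUniformization
import HarnessLib

/-!
# THEOREM 4 — ground fields of `p`-rank ≤ 1: discrete local uniformization for EVERY function field,
# from Theorem 1 (`DiscreteSepGenLU`) applied over the field of constants
# (lens-3 g8, sub-plan §10 of `Lines/valuative-constant-step-integrallayer.md`; crux `DescentPerfectToAll`,
# item stmt-ResolutionOfSingularities-0549; a BY-PRODUCT skeleton of the sub-line
# `Lines/separated_layer_sketch.lean`, NOT a registered skeleton of the crux; counted 0 — nothing here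
# proves resolution of singularities in characteristic `p`, rung B stays OPEN).

STATEMENT (`PRankLeOneDiscreteLU p`).  `k` of characteristic `p` with `[k : k^p] ≤ p` (typed as
`PRankLeOne p k`: `k = k^p[s]` for one `s`, which covers perfect `k`), `K/k` finitely generated, `O ⊇ k` a
discrete rank-one valuation ring of `K` — NO residue hypothesis — then `RelLocalUniformization k K O`.
Examples of such `k`: `𝔽_p(t)`, `𝔽_p((t))` (the field the Descent route header names as the place where
the only recorded descent mechanism breaks), `K₀((t))`, `K₀(t)` for perfect `K₀`, and all their algebraic
extensions.

PROOF (paper, §10.1).  `k' :=` algebraic closure of `k` in `K`: finite over `k`, contained in `O`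
(valuation rings are integrally closed), of the same `p`-rank.  MacLane: `K/k'` is separable iff
`K ⊗_{k'} k'^{1/p}` is a field iff `s' ∉ K^p` for the `p`-basis element `s'` of `k'`; and `s'^{1/p} ∈ K`
would be algebraic over `k`, hence in `k'`, contradicting `s' ∉ k'^p`.  So `K/k'` is f.g. separable =
separably generated (Mathlib: `exists_isTranscendenceBasis_and_isSeparable_of_linearIndepOn_pow_of_
essFiniteType` is MacLane (2) ⇒ (1); the `p`-rank-one computation gives (2) over `k'`).  Theorem 1 over
`k'` gives `RelLocalUniformization k' K O`, and relative LU transfers down the finite constant extension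
`k ⊆ k' ⊆ O` (adjoin a `k`-basis of `k'` to the given model).

KERNEL (no sorry): `prankLeOneDiscreteLU_of : DiscreteSepGenLU → ConstantFieldSplitting p →
AlgebraicMemValuationSubring → RelLUTransfer → PRankLeOneDiscreteLU p` and (rev 3) `constantFieldSplitting_of :
AlgebraicClosureFinite → MacLanePRankOne p → ConstantFieldSplitting p`.  REV 2 (g8, 2026-08-29):
STUBS B AND C ARE PROVED (`algebraicMemValuationSubring`: integrality transported along `k → O` +
`Valuation.Integers.isIntegral_iff_v_le_one`; `relLUTransfer`: adjoin the generators over `k'`,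
`IsFractionRing.of_field`, uniformise over `k'`, `Subalgebra.restrictScalars` + `Algebra.FiniteType.trans`
— the local ring at the centre is literally the same term).  REV 3 (g8, 2026-08-29): stub A
`ConstantFieldSplitting p` is SPLIT and two thirds of it PROVED: `constantFieldSplitting_of :
AlgebraicClosureFinite → MacLanePRankOne p → ConstantFieldSplitting p` — finite generation of `K` over
`k' := algebraicClosure k K` (`IntermediateField.fg_top_iff` + `Algebra.EssFiniteType.of_comp`) and the
extraction of a SEPARATING TRANSCENDENCE BASIS from MacLane's criterion (2) (Mathlib's
`exists_isTranscendenceBasis_and_isSeparable_of_linearIndepOn_pow_of_essFiniteType`, reindexed to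
`Fin d`) are kernel-checked.  REV 4: the MacLane computation itself is
PROVED (`pow_indep_of_not_pth_power`: `1, σ, …, σ^{p-1}` are linearly independent over `K^p` when
`σ ∉ K^p` — minimal polynomial `X^p − σ^p` over the Frobenius subfield; `linearIndepOn_pow_of_pRankOne`,
`linearIndepOn_pow_of_perfect`, `macLanePRankOne_of : AlgebraicClosureFinite → PRankInherited p →
MacLanePRankOne p`).  REV 5: A3′ `PRankInherited p` (finite extensions inherit `p`-rank ≤ 1) is PROVED:
`frob_finrank_le` (degree transport `[E : E^p] = [K₀ : K₀^p] ≤ p` along the towers `K₀^p ≤ K₀ ≤ E`,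
`K₀^p ≤ E^p ≤ E` with `Subfield.relfinrank_mul_relfinrank` and `Subfield.relfinrank_map_map (frobenius E p)`),
`pRankLeOne_of_frob` (`[E : E^p] ≤ p` ⟹ `E = E^p⟮s⟯ = ⊕_{j<p} E^p s^j` for any `s ∉ E^p`, power basis of
`IntermediateField.adjoin`), `pRankInherited`.  REV 6: A1 `AlgebraicClosureFinite` is PROVED
(`linearIndependent_over_adjoin`: a `k`-basis of `k'` stays `k(s)`-linearly independent for a finite
transcendence basis `s` — denominators cleared in `Frac k[s] = k(s)` (`IsLocalization.exist_integer_multiples`),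
`s` algebraically independent over `k'` (`AlgebraicIndependent.algebraicClosure`), coefficientwise vanishing;
then `rank_k k' ≤ rank_{k(s)} K < ℵ₀`).  NO STUB REMAINS: `prankLeOneDiscreteLU : DiscreteSepGenLU →
PRankLeOneDiscreteLU p` is sorry-free — THEOREM 4 is reduced ENTIRELY to Theorem 1 (`DiscreteSepGenLU`,
the separably generated case of discrete relative local uniformization).  REV 7: + sanity lemma
`pRankLeOne_of_perfect` (perfect fields have `p`-rank ≤ 1, so THEOREM 4 covers Theorem 1's own range and its
hypothesis is not vacuous).
`DiscreteSepGenLU` is Theorem 1 of the sketch (its own stubs P1, P2A, P2C, P2D, T3 paper-true per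
TRIAGE-34/50, P2B proved in `Lines/field_fibre_descends_regular.lean`).  Vocabulary `SepGen`, `DiscreteSepGenLU` copied verbatim from
`Lines/separated_layer_sketch.lean` (crux workfiles are not importable before a build).
-/

noncomputable section

set_option linter.dupNamespace false

open Literature.AlgebraicGeometry.Resolution

namespace Summit.ResolutionOfSingularities.ResolutionOfSingularities.Cruxes.DescentPerfectToAll.PRankLeOne

/-- `K/k` is SEPARABLY GENERATED (verbatim copy, g7/g8). -/
def SepGen (k K : Type) [Field k] [Field K] [Algebra k K] : Prop :=
  ∃ (d : ℕ) (x : Fin d → K), IsTranscendenceBasis k x ∧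
    Algebra.IsSeparable (IntermediateField.adjoin k (Set.range x)) K

/-- THEOREM 1 of the g8 sketch (verbatim copy of `SeparatedLayer.DiscreteSepGenLU`): separably generated
`K/k`, any residue field, relative LU at every discrete rank-one `O ⊇ k`. -/
def DiscreteSepGenLU : Prop :=
  ∀ (k K : Type) [Field k] [Field K] [Algebra k K], (⊤ : IntermediateField k K).FG →
    ∀ O : ValuationSubring K, (∀ c : k, algebraMap k K c ∈ O) → IsDiscreteValuationRing O →
      SepGen k K → RelLocalUniformization k K O

/-- `p`-RANK ≤ 1: `k = k^p[s]` for a single `s` (`s ∈ k^p` allowed, which is the perfect case). -/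
def PRankLeOne (p : ℕ) (k : Type) [Field k] : Prop :=
  ∃ s : k, ∀ c : k, ∃ f : Fin p → k, c = ∑ i, f i ^ p * s ^ (i : ℕ)

/-- Sanity instance (the hypothesis of THEOREM 4 is satisfiable and covers the perfect case): a perfect
field has `p`-rank ≤ 1 — take any `s`, `c = (c^{1/p})^p · s^0`. -/
theorem pRankLeOne_of_perfect (p : ℕ) [Fact p.Prime] (k : Type) [Field k] [CharP k p]
    [PerfectRing k p] : PRankLeOne p k := by
  classical
  have hp : p.Prime := Fact.out
  refine ⟨0, fun c => ?_⟩
  obtain ⟨d, hd⟩ := surjective_frobenius k p c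
  refine ⟨fun j => if (j : ℕ) = 0 then d else 0, ?_⟩
  rw [Finset.sum_eq_single (⟨0, hp.pos⟩ : Fin p)]
  · simp only [if_pos rfl, pow_zero, mul_one]
    simpa [frobenius_def] using hd.symm
  · intro j _ hj
    have : (j : ℕ) ≠ 0 := fun h => hj (Fin.ext h)
    simp [this, zero_pow hp.ne_zero]
  · intro h; exact absurd (Finset.mem_univ _) h

/-- THEOREM 4 (target): over a ground field of `p`-rank ≤ 1 every finitely generated `K` is
relatively uniformised at every discrete rank-one valuation ring containing `k`. -/
def PRankLeOneDiscreteLU (p : ℕ) : Prop :=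
  ∀ (k K : Type) [Field k] [CharP k p] [Field K] [Algebra k K], (⊤ : IntermediateField k K).FG →
    PRankLeOne p k →
    ∀ O : ValuationSubring K, (∀ c : k, algebraMap k K c ∈ O) → IsDiscreteValuationRing O →
      RelLocalUniformization k K O

/-- STUB A (split in rev 3 into A1 `AlgebraicClosureFinite` + A3 `MacLanePRankOne`, the rest proved:
`constantFieldSplitting_of`; MacLane for `p`-rank one).  With `k' := algebraicClosure k K`: `k'/k` is finite, `K/k'`
is finitely generated, and `K/k'` is separably generated — because the `p`-basis element of `k'` is not a
`p`-th power in `K` (its root would be algebraic over `k`), so `k'`-linearly independent families in `K`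
have `k'`-linearly independent `p`-th powers, and Mathlib's
`exists_isTranscendenceBasis_and_isSeparable_of_linearIndepOn_pow_of_essFiniteType` applies. -/
def ConstantFieldSplitting (p : ℕ) : Prop :=
  ∀ (k K : Type) [Field k] [CharP k p] [Field K] [Algebra k K], (⊤ : IntermediateField k K).FG →
    PRankLeOne p k →
      FiniteDimensional k (algebraicClosure k K) ∧
      (⊤ : IntermediateField (algebraicClosure k K) K).FG ∧
      SepGen (algebraicClosure k K) K

/-- STUB B (S): elements algebraic over `k` lie in every valuation ring containing `k` (valuation
rings are integrally closed; Mathlib `Valuation.Integers.mem_of_integral`). -/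
def AlgebraicMemValuationSubring : Prop :=
  ∀ (k K : Type) [Field k] [Field K] [Algebra k K] (O : ValuationSubring K),
    (∀ c : k, algebraMap k K c ∈ O) → ∀ x : K, IsAlgebraic k x → x ∈ O

/-- STUB C (S, bookkeeping): relative LU transfers down a finite constant extension `k ⊆ k' ⊆ O`
(adjoin a `k`-basis of `k'` to the given `k`-model; an `FG` `k'`-algebra is an `FG` `k`-algebra; the local
ring at the centre is literally the same). -/
def RelLUTransfer : Prop :=
  ∀ (k K : Type) [Field k] [Field K] [Algebra k K] (k' : IntermediateField k K),
    FiniteDimensional k k' → ∀ O : ValuationSubring K, (∀ c : k', (c : K) ∈ O) →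
      RelLocalUniformization k' K O → RelLocalUniformization k K O

/-- A1 (was STUB; PROVED in rev 6 — `algebraicClosureFinite`) (S–M; classical; no `p`): the algebraic closure `k'` of `k` in a finitely generated
extension `K` is finite over `k`.  Paper: choose a finite transcendence basis `x` of `K/k`; it stays
algebraically independent over `k'` (Mathlib `AlgebraicIndependent.algebraicClosure`), so `k'` and `k(x)`
are linearly disjoint over `k` and `[E : k] = [E(x) : k(x)] ≤ [K : k(x)] < ∞` for every finitely
generated `k ⊆ E ⊆ k'`; hence `[k' : k] ≤ [K : k(x)]`.  Why it might fail: only Lean (linear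
disjointness from algebraic independence is not yet a Mathlib lemma). -/
def AlgebraicClosureFinite : Prop :=
  ∀ (k K : Type) [Field k] [Field K] [Algebra k K], (⊤ : IntermediateField k K).FG →
    FiniteDimensional k (algebraicClosure k K)

/-- STUB A3 (M; MacLane for `p`-rank one — THE HEART).  Over `k' := algebraicClosure k K`, every
finite `k'`-linearly independent family in `K` has `k'`-linearly independent `p`-th powers
(MacLane's criterion (2) for `K/k'`).  Paper: (i) `[k' : k'^p] = [k : k^p] ≤ p` (`k'/k` finite — A1;
Frobenius gives `[k'^p : k^p] = [k' : k]`, and `[k' : k^p]` computed along both towers), so `k'` is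
perfect or `k' = ⊕_{j<p} k'^p s'^j` with `s' ∉ k'^p`; (ii) `s' ∉ K^p`: `s' = u^p`, `u ∈ K` ⟹ `u`
algebraic over `k` ⟹ `u ∈ k'`; (iii) if `∑ c_i y_i^p = 0` with `c_i = ∑_j d_{ij}^p s'^j ∈ k'`, then
`∑_j (∑_i d_{ij} y_i)^p s'^j = 0`, and `1, s', …, s'^{p−1}` are linearly independent over `K^p`
(`X^p − s'^p` is irreducible over `K^p` as `s'^p ∉ K^{p²}`), so `∑_i d_{ij} y_i = 0`, `d_{ij} = 0`, `c_i = 0`;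
the perfect case is `c_i = d_i^p`, `(∑ d_i y_i)^p = 0`.  Why it might fail: only Lean (towers of the
subfields `k^p ⊆ k ⊆ k'`, `k^p ⊆ k'^p ⊆ k'` and the Frobenius transport of `finrank`). -/
def MacLanePRankOne (p : ℕ) : Prop :=
  ∀ (k K : Type) [Field k] [CharP k p] [Field K] [Algebra k K], (⊤ : IntermediateField k K).FG →
    PRankLeOne p k →
      ∀ s : Finset K, LinearIndepOn (algebraicClosure k K) _root_.id (s : Set K) →
        LinearIndepOn (algebraicClosure k K) (· ^ p) (s : Set K)

section A1
open Module
open scoped IntermediateField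

open IntermediateField.algebraAdjoinAdjoin in
/-- Core: a `k`-linearly independent family in the algebraic closure `k'` of `k` in `K` stays
linearly independent over `k(s)` for an algebraically independent finite set `s`
(clear denominators; `s` stays algebraically independent over `k'`
— `AlgebraicIndependent.algebraicClosure` — so a polynomial relation with coefficients in `k'`
vanishes coefficientwise). -/
theorem linearIndependent_over_adjoin {k K : Type} [Field k] [Field K] [Algebra k K]
    (s : Finset K) (hs : AlgebraicIndependent k ((↑) : s → K)) {ι : Type} (b : ι → algebraicClosure k K)
    (hb : LinearIndependent k b) :
    LinearIndependent (IntermediateField.adjoin k (s : Set K)) (fun i => (b i : K)) := by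
  classical
  set F := IntermediateField.adjoin k (s : Set K) with hF
  set R := Algebra.adjoin k (s : Set K) with hRdef
  rw [linearIndependent_iff']
  intro S g hg i hi
  -- clear denominators in `F = Frac R`
  obtain ⟨d, hd⟩ := IsLocalization.exist_integer_multiples (nonZeroDivisors R) S g
  have hd' : ∀ i ∈ S, ∃ y : R, algebraMap R F y = (d : R) • g i := fun i hi => by
    obtain ⟨y, hy⟩ := hd i hi; exact ⟨y, hy⟩
  choose! r hr using hd'
  -- each `r i` is a polynomial in `s`
  have hRP : ∀ i, ∃ P : MvPolynomial s k, MvPolynomial.aeval ((↑) : s → K) P = (r i : K) := fun i => by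
    have h : (r i : K) ∈ (MvPolynomial.aeval ((↑) : s → K) : MvPolynomial s k →ₐ[k] K).range := by
      rw [← Algebra.adjoin_eq_range]; exact (r i).2
    exact (AlgHom.mem_range _).1 h
  choose P hP using hRP
  -- the cleared relation
  have hcoe : ∀ i ∈ S, (r i : K) = ((d : R) : K) * (g i : K) := fun i hi => by
    have h := congrArg (fun x : F => (x : K)) (hr i hi)
    simp only [coe_algebraMap, Algebra.smul_def, IntermediateField.coe_mul] at h
    exact h
  have hrel : ∑ i ∈ S, (b i : K) * (r i : K) = 0 := by
    have h2 : ∑ i ∈ S, (b i : K) * (r i : K) = ((d : R) : K) * ∑ i ∈ S, g i • (b i : K) := by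
      rw [Finset.mul_sum]
      refine Finset.sum_congr rfl fun i hi => ?_
      rw [hcoe i hi, Algebra.smul_def]
      show (b i : K) * (((d : R) : K) * (g i : K)) = ((d : R) : K) * ((g i : K) * (b i : K))
      ring
    rw [h2]
    simp only [hg, mul_zero]
  -- the polynomial over `A`
  let Q : MvPolynomial s (algebraicClosure k K) :=
    ∑ i ∈ S, MvPolynomial.C (b i) * MvPolynomial.map (algebraMap k (algebraicClosure k K)) (P i)
  have hQ : MvPolynomial.aeval ((↑) : s → K) Q = 0 := by
    simp only [Q, map_sum, map_mul, MvPolynomial.aeval_C, MvPolynomial.aeval_map_algebraMap, hP]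
    rw [← hrel]
    refine Finset.sum_congr rfl fun i _ => ?_
    rfl
  have hQ0 : Q = 0 :=
    (algebraicIndependent_iff_injective_aeval.mp hs.algebraicClosure) (hQ.trans (map_zero _).symm)
  have hcoeff : ∀ m, ∑ i ∈ S, (MvPolynomial.coeff m (P i)) • b i = 0 := fun m => by
    have h := congrArg (MvPolynomial.coeff m) hQ0
    simp only [Q, MvPolynomial.coeff_sum, MvPolynomial.coeff_C_mul, MvPolynomial.coeff_map,
      MvPolynomial.coeff_zero] at h
    rw [← h]
    refine Finset.sum_congr rfl fun i _ => ?_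
    rw [Algebra.smul_def, mul_comm]
  have hPz : P i = 0 := by
    ext m
    have h := (linearIndependent_iff'.mp hb) S (fun i => MvPolynomial.coeff m (P i)) (hcoeff m) i hi
    simpa using h
  -- conclude `g i = 0`
  have hri : r i = 0 := by
    apply Subtype.ext
    show (r i : K) = 0
    rw [← hP i, hPz, map_zero]
  have hdne : algebraMap R F (d : R) ≠ 0 :=
    IsFractionRing.to_map_ne_zero_of_mem_nonZeroDivisors (SetLike.coe_mem d)
  have h := hr i hi
  rw [hri, map_zero, Algebra.smul_def] at h
  rcases mul_eq_zero.mp h.symm with h1 | h1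
  · exact absurd h1 hdne
  · exact h1

/-- A1 — PROVED (rev 6): the algebraic closure of `k` in a finitely generated `K` is finite over `k`. -/
theorem algebraicClosureFinite : AlgebraicClosureFinite := by
  intro k K _ _ _ hfg
  classical
  haveI : Algebra.EssFiniteType k K := IntermediateField.fg_top_iff.mp hfg
  obtain ⟨s, hs, -⟩ := IntermediateField.exists_finset_maximalFor_isTranscendenceBasis_separableClosure (F := k) (E := K)
  set F := IntermediateField.adjoin k (s : Set K) with hF
  set A := algebraicClosure k K with hA
  -- (1) `K` is finite over `F`
  haveI halgK : Algebra.IsAlgebraic F K := by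
    have := hs.isAlgebraic_field
    rwa [Subtype.range_coe] at this
  haveI : FiniteDimensional F K := by
    obtain ⟨T, hT⟩ := hfg
    haveI : FiniteDimensional F (IntermediateField.adjoin F (T : Set K)) :=
      IntermediateField.finiteDimensional_adjoin fun x _ =>
        (Algebra.IsAlgebraic.isAlgebraic (R := F) x).isIntegral
    have htop : IntermediateField.adjoin F (T : Set K) = ⊤ := by
      rw [eq_top_iff]
      intro x _
      have hx : x ∈ IntermediateField.adjoin k (T : Set K) := by rw [hT]; trivial
      have hle : IntermediateField.adjoin k (T : Set K) ≤
          (IntermediateField.adjoin F (T : Set K)).restrictScalars k :=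
        IntermediateField.adjoin_le_iff.mpr (IntermediateField.subset_adjoin F (T : Set K))
      exact hle hx
    have e := (IntermediateField.topEquiv (F := F) (E := K)).toLinearEquiv
    rw [← htop] at e
    exact LinearEquiv.finiteDimensional e
  -- (2) a `k`-basis of `A` is `F`-linearly independent in `K`
  let b := Module.Free.chooseBasis k A
  have H : LinearIndependent F (fun i => (b i : K)) :=
    linearIndependent_over_adjoin s hs.1 b b.linearIndependent
  -- (3) ranks
  have h1 := H.cardinal_le_rank
  have h2 := b.mk_eq_rank''
  have h3 : Module.rank F K < Cardinal.aleph0 := Module.rank_lt_aleph0_iff.mpr ‹_›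
  have h4 : Module.rank k A < Cardinal.aleph0 := by rw [← h2]; exact h1.trans_lt h3
  exact Module.rank_lt_aleph0_iff.mp h4

end A1

/-- A3′ (was STUB, S–M; PROVED in rev 5): `p`-rank ≤ 1 is INHERITED by the algebraic closure `k'` of `k` in
`K`, indeed by ANY finite extension `E` of `k` (pure field theory, decoupled from A1).  Paper: Frobenius gives `[k'^p : k^p] = [k' : k]`; computing
`[k' : k^p]` along `k^p ⊆ k ⊆ k'` and `k^p ⊆ k'^p ⊆ k'` yields `[k' : k'^p] = [k : k^p] ≤ p`, and a
field with `[k' : k'^p] ≤ p` is `k'^p[s']` for any `s' ∉ k'^p` (degree `p` over `k'^p`) or perfect.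
Status: PROVED below (`pRankInherited`). -/
def PRankInherited (p : ℕ) : Prop :=
  ∀ (k E : Type) [Field k] [CharP k p] [Field E] [Algebra k E], FiniteDimensional k E →
    PRankLeOne p k → PRankLeOne p E

section Inherit
open Polynomial Module
open scoped IntermediateField

/-- T2 (degree transport along Frobenius): if `E` is finite over a subfield `K0` of `p`-rank ≤ 1,
then `E` is finite over `E^p` of degree `≤ p` (indeed `[E : E^p] = [K0 : K0^p]`). -/
theorem frob_finrank_le {E : Type} [Field E] (p : ℕ) [Fact p.Prime] [CharP E p]
    (K0 : Subfield E) [FiniteDimensional K0 E] (hK0 : PRankLeOne p K0) :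
    FiniteDimensional (frobenius E p).fieldRange E ∧
      finrank (frobenius E p).fieldRange E ≤ p := by
  classical
  have hp : p.Prime := Fact.out
  set φ := frobenius E p with hφ
  set Ep : Subfield E := φ.fieldRange with hEp
  set K0p : Subfield E := K0.map φ with hK0p
  have h1 : K0p ≤ K0 := by
    rintro _ ⟨y, hy, rfl⟩
    simpa [hφ, frobenius_def] using K0.pow_mem hy p
  have h2 : K0p ≤ Ep := by
    rintro _ ⟨y, -, rfl⟩; exact ⟨y, rfl⟩
  have hn : Subfield.relfinrank K0 ⊤ = finrank K0 E := Subfield.relfinrank_top_right K0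
  have hnpos : 0 < finrank K0 E := finrank_pos
  have hm : Subfield.relfinrank K0p Ep = finrank K0 E := by
    rw [hEp, RingHom.fieldRange_eq_map, hK0p, Subfield.relfinrank_map_map, Subfield.relfinrank_top_right]
  have t1 := Subfield.relfinrank_mul_relfinrank h1 (le_top : K0 ≤ ⊤)
  have t2 := Subfield.relfinrank_mul_relfinrank h2 (le_top : Ep ≤ ⊤)
  -- `a := [K0 : K0^p]` is positive and `≤ p`
  have ha : 0 < Subfield.relfinrank K0p K0 ∧ Subfield.relfinrank K0p K0 ≤ p := by
    rw [Subfield.relfinrank_eq_finrank_of_le h1]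
    obtain ⟨s₀, hs₀⟩ := hK0
    set X := Subfield.extendScalars h1 with hX
    let g : Fin p → X := fun j => ⟨(s₀ : E) ^ (j : ℕ), by
      rw [Subfield.mem_extendScalars]; exact K0.pow_mem s₀.2 _⟩
    have hspan : Submodule.span K0p (Set.range g) = ⊤ := by
      rw [eq_top_iff]
      rintro ⟨c, hc⟩ -
      have hcK : c ∈ K0 := (Subfield.mem_extendScalars h1).mp hc
      obtain ⟨f, hf⟩ := hs₀ ⟨c, hcK⟩
      have hf' := congrArg K0.subtype hf
      simp only [map_sum, map_mul, map_pow, Subfield.coe_subtype] at hf'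
      have hcoef : ∀ j : Fin p, ((f j : E)) ^ p ∈ K0p := fun j =>
        Subfield.mem_map.mpr ⟨(f j : E), (f j).2, by simp [hφ, frobenius_def]⟩
      have key : (⟨c, hc⟩ : X) = ∑ j, (⟨((f j : E)) ^ p, hcoef j⟩ : K0p) • g j := by
        apply Subtype.ext
        change c = ((∑ j, (⟨((f j : E)) ^ p, hcoef j⟩ : K0p) • g j : X) : E)
        rw [hf', IntermediateField.coe_sum]
        refine Finset.sum_congr rfl fun j _ => ?_
        rw [IntermediateField.coe_smul, Algebra.smul_def]
        rfl
      rw [key]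
      exact Submodule.sum_mem _ fun j _ => Submodule.smul_mem _ _ (Submodule.subset_span ⟨j, rfl⟩)
    haveI hfin : FiniteDimensional K0p X :=
      Module.finite_def.mpr (hspan ▸ Submodule.fg_span (Set.finite_range g))
    refine ⟨finrank_pos, ?_⟩
    rw [← finrank_top (R := K0p) (M := X), ← hspan]
    exact (finrank_range_le_card g).trans (by simp)
  have hab : Subfield.relfinrank K0p K0 = Subfield.relfinrank Ep ⊤ := by
    have := t1.trans t2.symm
    rw [hn, hm, mul_comm] at this
    exact Nat.eq_of_mul_eq_mul_left hnpos this
  have hb : Subfield.relfinrank Ep ⊤ = finrank Ep E := Subfield.relfinrank_top_right Ep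
  refine ⟨?_, ?_⟩
  · exact Module.finite_of_finrank_pos (by rw [← hb, ← hab]; exact ha.1)
  · rw [← hb, ← hab]; exact ha.2

/-- T1: if `[E : E^p] ≤ p` (finite), then `E` has `p`-rank ≤ 1: `E = ⊕_{j<p} E^p s^j` for any
`s ∉ E^p` (or `E` is perfect). -/
theorem pRankLeOne_of_frob {E : Type} [Field E] (p : ℕ) [Fact p.Prime] [CharP E p]
    [FiniteDimensional (frobenius E p).fieldRange E]
    (hle : finrank (frobenius E p).fieldRange E ≤ p) : PRankLeOne p E := by
  classical
  have hp : p.Prime := Fact.out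
  set Ep : Subfield E := (frobenius E p).fieldRange with hEp
  have hmem : ∀ y : E, y ^ p ∈ Ep := fun y => ⟨y, by simp [frobenius_def]⟩
  by_cases htop : Ep = ⊤
  · refine ⟨0, fun c => ?_⟩
    obtain ⟨d, hd⟩ : ∃ d : E, d ^ p = c := by
      have hc : c ∈ Ep := htop ▸ Subfield.mem_top c
      obtain ⟨d, hd⟩ := hc
      exact ⟨d, by simpa [frobenius_def] using hd⟩
    refine ⟨fun j => if (j : ℕ) = 0 then d else 0, ?_⟩
    rw [Finset.sum_eq_single (⟨0, hp.pos⟩ : Fin p)]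
    · simp [hd]
    · intro j _ hj
      have : (j : ℕ) ≠ 0 := fun h => hj (Fin.ext h)
      simp [this, zero_pow hp.ne_zero]
    · intro h; exact absurd (Finset.mem_univ _) h
  · obtain ⟨s, hsE⟩ : ∃ s : E, s ∉ Ep := by
      by_contra h
      push_neg at h
      exact htop (eq_top_iff.mpr fun x _ => h x)
    have hs : ∀ u : E, u ^ p ≠ s := fun u hu => hsE (hu ▸ hmem u)
    -- minimal polynomial of `s` over `Ep`
    let a : Ep := ⟨s ^ p, hmem s⟩
    have hirr : Irreducible (X ^ p - C a : Ep[X]) := by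
      refine X_pow_sub_C_irreducible_of_prime hp fun b hb => ?_
      obtain ⟨v, hv⟩ : ∃ v : E, v ^ p = (b : E) := by
        obtain ⟨v, hv⟩ := b.2; exact ⟨v, by simpa [frobenius_def] using hv⟩
      have hb' : ((b : E)) ^ p = s ^ p := by
        have := congrArg Subtype.val hb; simpa [a] using this
      apply hs v
      have h1 : (v ^ p) ^ p = s ^ p := by rw [hv]; exact hb'
      exact frobenius_inj E p (by simpa [frobenius_def] using h1)
    have hroot : aeval s (X ^ p - C a : Ep[X]) = 0 := by
      simp only [map_sub, map_pow, aeval_X, aeval_C]; exact sub_self _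
    have hmonic : (X ^ p - C a : Ep[X]).Monic := monic_X_pow_sub_C a hp.ne_zero
    have hmin : (X ^ p - C a : Ep[X]) = minpoly Ep s :=
      minpoly.eq_of_irreducible_of_monic hirr hroot hmonic
    have hint : IsIntegral Ep s := Algebra.IsIntegral.isIntegral s
    have hdeg : (minpoly Ep s).natDegree = p := by rw [← hmin, natDegree_X_pow_sub_C]
    have hfr : finrank Ep Ep⟮s⟯ = p := by rw [IntermediateField.adjoin.finrank hint, hdeg]
    have htop' : Ep⟮s⟯ = ⊤ :=
      IntermediateField.eq_of_le_of_finrank_le le_top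
        (by rw [IntermediateField.finrank_top', hfr]; exact hle)
    refine ⟨s, fun c => ?_⟩
    have hc : c ∈ Ep⟮s⟯ := by rw [htop']; trivial
    let pb := IntermediateField.adjoin.powerBasis hint
    have hdim : pb.dim = p := by
      show (minpoly Ep s).natDegree = p; exact hdeg
    set x : Ep⟮s⟯ := ⟨c, hc⟩ with hx
    have hrepr := pb.basis.sum_repr x
    -- coefficients are `p`-th powers
    choose v hv using fun i : Fin pb.dim => (pb.basis.repr x i).2
    have hv' : ∀ i, v i ^ p = ((pb.basis.repr x i : Ep) : E) := fun i => by
      simpa [frobenius_def] using hv i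
    -- push `hrepr` into `E`
    have hE : c = ∑ i : Fin pb.dim, v i ^ p * s ^ (i : ℕ) := by
      have h1 : ((∑ i, pb.basis.repr x i • pb.basis i : Ep⟮s⟯) : E) = c := by
        rw [hrepr]
      rw [IntermediateField.coe_sum] at h1
      have h2 : ∀ i : Fin pb.dim, (((pb.basis.repr x i) • pb.basis i : Ep⟮s⟯) : E)
          = v i ^ p * s ^ (i : ℕ) := by
        intro i
        rw [IntermediateField.coe_smul, Algebra.smul_def, hv', PowerBasis.coe_basis]
        simp only [pb, IntermediateField.adjoin.powerBasis_gen]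
        rw [IntermediateField.coe_pow, IntermediateField.AdjoinSimple.coe_gen]
        rfl
      rw [Finset.sum_congr rfl fun i _ => h2 i] at h1
      exact h1.symm
    refine ⟨fun j => v ((finCongr hdim).symm j), ?_⟩
    rw [hE]
    exact Fintype.sum_equiv (finCongr hdim) _ _ fun i => by simp

/-- A3′ — PROVED: finite extensions inherit `p`-rank ≤ 1. -/
theorem pRankInherited (p : ℕ) [Fact p.Prime] : PRankInherited p := by
  intro k E _ _ _ _ hfin hk
  haveI := hfin
  haveI : CharP E p := charP_of_injective_algebraMap (algebraMap k E).injective p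
  let K0 : Subfield E := (algebraMap k E).fieldRange
  let e : k ≃+* K0 := (algebraMap k E).rangeRestrictFieldEquiv
  have hc : (algebraMap K0 E).comp e.toRingHom = (RingEquiv.refl E).toRingHom.comp (algebraMap k E) := by
    ext x; rfl
  have hfr : finrank k E = finrank K0 E := Algebra.finrank_eq_of_equiv_equiv e (RingEquiv.refl E) hc
  haveI : FiniteDimensional K0 E :=
    Module.finite_of_finrank_pos (by rw [← hfr]; exact finrank_pos)
  have hK0 : PRankLeOne p K0 := by
    obtain ⟨s, hs⟩ := hk
    refine ⟨e s, fun c => ?_⟩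
    obtain ⟨f, hf⟩ := hs (e.symm c)
    refine ⟨fun j => e (f j), ?_⟩
    have := congrArg e hf
    simpa [map_sum, map_mul, map_pow] using this
  obtain ⟨hfinE, hle⟩ := frob_finrank_le p K0 hK0
  exact pRankLeOne_of_frob p hle

end Inherit

open Polynomial in
/-- Powers `1, σ, …, σ^{p-1}` of an element `σ ∉ K^p` are linearly independent over `K^p`:
if `∑_{j<p} Y_j^p σ^j = 0` then all `Y_j = 0`. -/
theorem pow_indep_of_not_pth_power {K : Type} [Field K] (p : ℕ) [Fact p.Prime] [CharP K p]
    (σ : K) (hσ : ∀ u : K, u ^ p ≠ σ) (Y : Fin p → K)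
    (hrel : ∑ j : Fin p, Y j ^ p * σ ^ (j : ℕ) = 0) : ∀ j, Y j = 0 := by
  have hp : p.Prime := Fact.out
  -- the subfield `K^p`
  let Kp : Subfield K := (frobenius K p).fieldRange
  have hmem : ∀ y : K, y ^ p ∈ Kp := fun y => ⟨y, rfl⟩
  -- the polynomial `P = ∑ C (Y_j^p) X^j ∈ Kp[X]`
  let c : Fin p → Kp := fun j => ⟨Y j ^ p, hmem (Y j)⟩
  let P : Kp[X] := ∑ j : Fin p, C (c j) * X ^ (j : ℕ)
  have hPσ : aeval σ P = 0 := by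
    simp only [P, map_sum, map_mul, aeval_C, map_pow, aeval_X]
    exact hrel
  have hdegP : P.degree < p := degree_sum_fin_lt c
  -- minimal polynomial of `σ` over `Kp` is `X^p - C (σ^p)`
  let a : Kp := ⟨σ ^ p, hmem σ⟩
  have hirr : Irreducible (X ^ p - C a : Kp[X]) := by
    refine X_pow_sub_C_irreducible_of_prime hp fun b hb => ?_
    obtain ⟨v, hv⟩ : ∃ v : K, v ^ p = (b : K) := by
      obtain ⟨v, hv⟩ := b.2; exact ⟨v, by simpa [frobenius_def] using hv⟩
    have hb' : ((b : K)) ^ p = σ ^ p := by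
      have := congrArg Subtype.val hb; simpa [a] using this
    apply hσ v
    have h1 : (v ^ p) ^ p = σ ^ p := by rw [hv]; exact hb'
    exact frobenius_inj K p (by simpa [frobenius_def] using h1)
  have hroot : aeval σ (X ^ p - C a : Kp[X]) = 0 := by
    simp only [map_sub, map_pow, aeval_X, aeval_C]; exact sub_self _
  have hmonic : (X ^ p - C a : Kp[X]).Monic := monic_X_pow_sub_C a hp.ne_zero
  have hmin : (X ^ p - C a : Kp[X]) = minpoly Kp σ := minpoly.eq_of_irreducible_of_monic hirr hroot hmonic
  have hdegmin : (minpoly Kp σ).degree = p := by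
    rw [← hmin, degree_X_pow_sub_C hp.pos]
  -- hence `P = 0`
  have hP0 : P = 0 := by
    by_contra hne
    have := minpoly.degree_le_of_ne_zero Kp σ hne hPσ
    rw [hdegmin] at this
    exact absurd (lt_of_le_of_lt this hdegP) (lt_irrefl _)
  -- read off coefficients
  intro j
  have hcoeff : P.coeff j = c j := by
    simp only [P, finset_sum_coeff, coeff_C_mul_X_pow]
    rw [Finset.sum_eq_single j, if_pos rfl]
    · intro b _ hb; rw [if_neg]; exact fun h => hb (Fin.ext h.symm)
    · intro h; exact absurd (Finset.mem_univ j) h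
  rw [hP0, coeff_zero] at hcoeff
  have : (Y j) ^ p = 0 := by
    have := congrArg Subtype.val hcoeff; simpa [c] using this.symm
  exact pow_eq_zero_iff (hp.ne_zero) |>.mp this
/-- MacLane's criterion (2) for `K/L` when `L = ⊕_{j<p} L^p s^j` with `s ∉ K^p`. -/
theorem linearIndepOn_pow_of_pRankOne {L K : Type} [Field L] [Field K] [Algebra L K] (p : ℕ)
    [Fact p.Prime] [CharP K p] (s : L) (hspan : ∀ c : L, ∃ f : Fin p → L, c = ∑ j, f j ^ p * s ^ (j : ℕ))
    (hs : ∀ u : K, u ^ p ≠ algebraMap L K s) (t : Finset K)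
    (ht : LinearIndepOn L _root_.id (t : Set K)) : LinearIndepOn L (· ^ p) (t : Set K) := by
  classical
  have hp : p.Prime := Fact.out
  rw [LinearIndepOn, linearIndependent_iff'] at ht ⊢
  intro S g hrel i hi
  choose f hf using fun i : ↥(t : Set K) => hspan (g i)
  -- `Y j := ∑_i f i j • y_i`
  let Y : Fin p → K := fun j => ∑ i ∈ S, f i j • ((i : K))
  have hY : ∑ j : Fin p, Y j ^ p * (algebraMap L K s) ^ (j : ℕ) = 0 := by
    have h1 : ∀ j : Fin p, Y j ^ p = ∑ i ∈ S, (algebraMap L K (f i j)) ^ p * (i : K) ^ p := by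
      intro j; simp only [Y, Algebra.smul_def]; rw [sum_pow_char p]; simp [mul_pow]
    simp_rw [h1, Finset.sum_mul]
    rw [Finset.sum_comm]
    have h2 : ∀ i ∈ S, ∑ j : Fin p, (algebraMap L K (f i j)) ^ p * (i : K) ^ p * (algebraMap L K s) ^ (j : ℕ)
        = g i • ((fun x : K => x ^ p) (i : K)) := by
      intro i _
      rw [hf i, Algebra.smul_def, map_sum, Finset.sum_mul]
      refine Finset.sum_congr rfl fun j _ => ?_
      simp only [map_mul, map_pow]; ring
    rw [Finset.sum_congr rfl h2]; exact hrel
  have hY0 := pow_indep_of_not_pth_power p (algebraMap L K s) hs Y hY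
  -- each `Y j = 0` gives `f i j = 0`
  have hf0 : ∀ j, ∀ i ∈ S, f i j = 0 := fun j => ht S (fun i => f i j) (by simpa [Y] using hY0 j)
  rw [hf i]
  exact Finset.sum_eq_zero fun j _ => by rw [hf0 j i hi, zero_pow hp.ne_zero, zero_mul]

/-- MacLane's criterion (2) for `K/L` when `L` is perfect. -/
theorem linearIndepOn_pow_of_perfect {L K : Type} [Field L] [Field K] [Algebra L K] (p : ℕ)
    [Fact p.Prime] [CharP K p] (hperf : ∀ c : L, ∃ d : L, c = d ^ p) (t : Finset K)
    (ht : LinearIndepOn L _root_.id (t : Set K)) : LinearIndepOn L (· ^ p) (t : Set K) := by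
  classical
  have hp : p.Prime := Fact.out
  rw [LinearIndepOn, linearIndependent_iff'] at ht ⊢
  intro S g hrel i hi
  choose d hd using fun i : ↥(t : Set K) => hperf (g i)
  have h1 : (∑ i ∈ S, d i • (i : K)) ^ p = 0 := by
    rw [sum_pow_char p]
    have : ∀ i ∈ S, (d i • (i : K)) ^ p = g i • ((fun x : K => x ^ p) (i : K)) := by
      intro i _; simp only [Algebra.smul_def, mul_pow, ← map_pow, ← hd i]
    rw [Finset.sum_congr rfl this]; exact hrel
  have h2 := ht S d ((pow_eq_zero_iff hp.ne_zero).mp h1)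
  rw [hd i, h2 i hi, zero_pow hp.ne_zero]

/-- A3 from A3′ — PROVED (rev 4): the `p`-basis element `s'` of `k'` is either a `p`-th power in `K`
(then, `k'` being algebraically closed in `K`, `k'` is perfect) or not (then `1, s', …, s'^{p-1}` are
linearly independent over `K^p`, `pow_indep_of_not_pth_power`); MacLane (2) follows in both cases. -/
theorem macLanePRankOne_of (p : ℕ) [Fact p.Prime] (hA1 : AlgebraicClosureFinite)
    (h : PRankInherited p) : MacLanePRankOne p := by
  intro k K _ _ _ _ hfg hpr t ht
  have hp : p.Prime := Fact.out
  haveI : CharP K p := charP_of_injective_algebraMap (algebraMap k K).injective p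
  haveI : CharP (algebraicClosure k K) p :=
    charP_of_injective_algebraMap (algebraMap k (algebraicClosure k K)).injective p
  obtain ⟨s', hs'⟩ := h k (algebraicClosure k K) (hA1 k K hfg) hpr
  by_cases hu : ∃ u : K, u ^ p = (s' : K)
  · obtain ⟨u, hu⟩ := hu
    have hualg : IsAlgebraic k u := by
      have h1 : IsAlgebraic k (u ^ p) := by
        rw [hu]; exact mem_algebraicClosure_iff.mp s'.2
      exact IsAlgebraic.of_pow hp.pos h1
    let u' : algebraicClosure k K := ⟨u, mem_algebraicClosure_iff.mpr hualg⟩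
    have hu' : u' ^ p = s' := Subtype.ext (by simpa using hu)
    refine linearIndepOn_pow_of_perfect p (L := algebraicClosure k K) ?_ t ht
    intro c
    obtain ⟨f, hf⟩ := hs' c
    refine ⟨∑ j, f j * u' ^ (j : ℕ), ?_⟩
    rw [hf, sum_pow_char p]
    exact Finset.sum_congr rfl fun j _ => by rw [mul_pow, ← hu', pow_right_comm]
  · push_neg at hu
    exact linearIndepOn_pow_of_pRankOne p s' hs' (fun u => hu u) t ht

/-- A2 — PROVED (rev 3): finite generation passes up the tower `k ⊆ L ⊆ K`. -/
theorem topFG_of_tower {k K : Type} [Field k] [Field K] [Algebra k K] (L : IntermediateField k K)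
    (h : (⊤ : IntermediateField k K).FG) : (⊤ : IntermediateField L K).FG := by
  have : Algebra.EssFiniteType k K := IntermediateField.fg_top_iff.mp h
  have : Algebra.EssFiniteType L K := Algebra.EssFiniteType.of_comp k L K
  exact IntermediateField.fg_top L K

/-- MacLane (2) ⇒ (1) — PROVED (rev 3) from Mathlib's
`exists_isTranscendenceBasis_and_isSeparable_of_linearIndepOn_pow_of_essFiniteType`, reindexed to the
`Fin d`-shape of `SepGen`. -/
theorem sepGen_of_linearIndepOn_pow {L K : Type} [Field L] [Field K] [Algebra L K] (p : ℕ)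
    [Fact p.Prime] [CharP L p] [Algebra.EssFiniteType L K]
    (H : ∀ s : Finset K, LinearIndepOn L _root_.id (s : Set K) →
      LinearIndepOn L (· ^ p) (s : Set K)) :
    SepGen L K := by
  have : ExpChar L p := ExpChar.prime Fact.out
  obtain ⟨s, hs, hsep⟩ :=
    exists_isTranscendenceBasis_and_isSeparable_of_linearIndepOn_pow_of_essFiniteType p Fact.out H
  refine ⟨s.card, ((↑) : s → K) ∘ s.equivFin.symm,
    (isTranscendenceBasis_equiv s.equivFin.symm).mpr hs, ?_⟩
  have hr : Set.range (((↑) : s → K) ∘ s.equivFin.symm) = (s : Set K) := by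
    rw [EquivLike.range_comp]; ext x; simp
  rw [hr]; exact hsep

/-- STUB A ASSEMBLED — PROVED (rev 3) from A1 and A3: `k'` gets characteristic `p` from `k`,
`K` is essentially of finite type over `k'` (A2), and A3 feeds `sepGen_of_linearIndepOn_pow`. -/
theorem constantFieldSplitting_of (p : ℕ) [Fact p.Prime] (hA1 : AlgebraicClosureFinite)
    (hA3 : MacLanePRankOne p) : ConstantFieldSplitting p := by
  intro k K _ _ _ _ hfg hpr
  haveI : CharP (algebraicClosure k K) p :=
    charP_of_injective_algebraMap (algebraMap k (algebraicClosure k K)).injective p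
  have : Algebra.EssFiniteType k K := IntermediateField.fg_top_iff.mp hfg
  have : Algebra.EssFiniteType (algebraicClosure k K) K :=
    Algebra.EssFiniteType.of_comp k (algebraicClosure k K) K
  exact ⟨hA1 k K hfg, IntermediateField.fg_top _ K,
    sepGen_of_linearIndepOn_pow p (hA3 k K hfg hpr)⟩

/-- STUB B — **PROVED** (rev 2): integrality over `k` transported along `k → O`, then
`Valuation.Integers.isIntegral_iff_v_le_one`. -/
theorem algebraicMemValuationSubring : AlgebraicMemValuationSubring := by
  intro k K _ _ _ O hk x hx
  obtain ⟨f, hfm, hfx⟩ := hx.isIntegral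
  let φ : k →+* O :=
    { toFun := fun c => ⟨algebraMap k K c, hk c⟩
      map_one' := Subtype.ext (by simp)
      map_mul' := fun a b => Subtype.ext (by simp)
      map_zero' := Subtype.ext (by simp)
      map_add' := fun a b => Subtype.ext (by simp) }
  have hφ : (algebraMap O K).comp φ = algebraMap k K := RingHom.ext fun c => rfl
  have hint : IsIntegral O x := by
    refine ⟨f.map φ, hfm.map φ, ?_⟩
    rw [Polynomial.eval₂_map, hφ]
    exact hfx
  have hv : O.valuation.Integers O := by
    have h := Valuation.valuationSubring.integers (v := O.valuation)
    rwa [ValuationSubring.valuationSubring_valuation] at h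
  exact (O.valuation_le_one_iff x).mp ((Valuation.Integers.isIntegral_iff_v_le_one hv).mp hint)

/-- STUB C — **PROVED** (rev 2): adjoin the generators of the `k`-model over `k'`, uniformise over
`k'`, restrict scalars (`Algebra.FiniteType.trans` along `k → k' → A'`; the local ring at the centre is
literally the same ring). -/
theorem relLUTransfer : RelLUTransfer := by
  intro k K _ _ _ k' hfin O hk' hLU R hRfg hfrac hRO
  classical
  obtain ⟨s, hs⟩ := hRfg
  -- the `k'`-model generated by the generators of `R`
  let R' : Subalgebra k' K := Algebra.adjoin k' (s : Set K)
  have hsR : ∀ y : K, y ∈ s → y ∈ R := by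
    intro y hy
    rw [← hs]
    exact Algebra.subset_adjoin (Finset.mem_coe.mpr hy)
  have hle : Algebra.adjoin k (s : Set K) ≤ R'.restrictScalars k := by
    apply Algebra.adjoin_le
    rw [Subalgebra.coe_restrictScalars]
    exact Algebra.subset_adjoin
  have hRR' : ∀ x : K, x ∈ R → x ∈ R' := by
    intro x hx
    rw [← hs] at hx
    exact (Subalgebra.mem_restrictScalars k).mp (hle hx)
  -- `O` as a `k'`-subalgebra
  let O' : Subalgebra k' K :=
    { carrier := O
      mul_mem' := fun ha hb => O.mul_mem _ _ ha hb
      one_mem' := O.one_mem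
      add_mem' := fun ha hb => O.add_mem _ _ ha hb
      zero_mem' := O.zero_mem
      algebraMap_mem' := fun c => hk' c }
  have hsO' : (s : Set K) ⊆ (O' : Set K) := fun y hy => hRO (hsR y (Finset.mem_coe.mp hy))
  have hR'O : R'.toSubring ≤ O.toSubring := by
    have hle' : R' ≤ O' := Algebra.adjoin_le hsO'
    intro x hx
    exact hle' hx
  have hR'fg : R'.FG := ⟨s, rfl⟩
  haveI : FaithfulSMul R' K :=
    (faithfulSMul_iff_algebraMap_injective R' K).mpr Subtype.val_injective
  have hfrac' : IsFractionRing R' K := by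
    refine IsFractionRing.of_field (R := R') (K := K) fun z => ?_
    obtain ⟨a, b, -, hab⟩ := IsFractionRing.div_surjective (A := R) z
    exact ⟨⟨(a : K), hRR' a a.2⟩, ⟨(b : K), hRR' b b.2⟩, hab.symm⟩
  obtain ⟨A', hA'O, hR'A', hA'fg, hreg⟩ := hLU R' hR'fg hfrac' hR'O
  refine ⟨A'.restrictScalars k, hA'O, fun x hx => hR'A' (hRR' x hx), ?_, hreg⟩
  -- `FG` over `k`: finite type is transitive along `k → k' → A'`
  haveI : Algebra.FiniteType k' A' := (Subalgebra.fg_iff_finiteType A').mp hA'fg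
  haveI : Module.Finite k k' := hfin
  have hft : Algebra.FiniteType k A' :=
    Algebra.FiniteType.trans (R := k) (S := k') (A := A') inferInstance inferInstance
  exact (Subalgebra.fg_iff_finiteType (A'.restrictScalars k)).mpr hft

/-- KERNEL of THEOREM 4 (no sorry): Theorem 1 over the field of constants. -/
theorem prankLeOneDiscreteLU_of (p : ℕ) (h1 : DiscreteSepGenLU) (hA : ConstantFieldSplitting p)
    (hB : AlgebraicMemValuationSubring) (hC : RelLUTransfer) : PRankLeOneDiscreteLU p := by
  intro k K _ _ _ _ hfg hpr O hk hO
  obtain ⟨hfin, hfg', hsep⟩ := hA k K hfg hpr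
  have hk' : ∀ c : algebraicClosure k K, ((c : K)) ∈ O := fun c =>
    hB k K O hk c (mem_algebraicClosure_iff.mp c.2)
  refine hC k K (algebraicClosure k K) hfin O hk' ?_
  exact h1 (algebraicClosure k K) K hfg' O (fun c => by simpa using hk' c) hO hsep

/-- THEOREM 4 from Theorem 1 ALONE (rev 6: no stub, no sorry in this file). -/
theorem prankLeOneDiscreteLU (p : ℕ) [Fact p.Prime] (h1 : DiscreteSepGenLU) :
    PRankLeOneDiscreteLU p :=
  prankLeOneDiscreteLU_of p h1
    (constantFieldSplitting_of p algebraicClosureFinite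
      (macLanePRankOne_of p algebraicClosureFinite (pRankInherited p)))
    algebraicMemValuationSubring relLUTransfer

end Summit.ResolutionOfSingularities.ResolutionOfSingularities.Cruxes.DescentPerfectToAll.PRankLeOne
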